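import Summits.ResolutionOfSingularities.ResolutionOfSingularities.Theorems.HomologicalConductorNoZenoSplitExcCount
import Literature.FieldTheory.Regular.FiniteAlgebraicClosureAnyChar
import Mathlib.AlgebraicGeometry.Morphisms.FiniteType
import HarnessLib

/-!
# Crux `NoZenoR` (stmt-ResolutionOfSingularities-19943), β layer — U8 companion: the separable closure of the base
# residue field in `κ(η)` is FINITE for every point of a scheme locally of finite type (discharge of the binder `hFW`)

Route `ResolutionOfSingularities/HomologicalConductor`, crux chain W4.4.  OURS (cell res-hironaka; planner res-L0-w44-plan-1
CHAIN v24 (ρ38f) «hFW-DISCHARGE lemma», consumer res-L0-w44-stub-2's `…NoZenoSplitCountBaseChange` with its explicit binder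
`hFW : FiniteDimensional κ(𝔪) (separableClosure κ(𝔪) κ(η))`); AI-written, weaker than expert review; nothing of the manuscript
under review (Hironaka 2017) is used or asserted.  Def-free, `--supports 19943 --as helper`.

For a scheme `π : X → Spec R` LOCALLY OF FINITE TYPE and ANY point `η ∈ X`, the residue field `κ(η)` is essentially of
finite type over the residue field `κ(π η)` of the base point (Mathlib `LocallyOfFiniteType.stalkMap`: `𝒪_{X,η}` is
essentially of finite type over `𝒪_{Spec R, π η}`; `X.residue η` is surjective; the naturality square
`Scheme.residue_residueFieldMap`), hence — by the tree's THEOREM `Literature.FieldTheory.Regular.finiteDimensional_algebraicClosure`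
(Serre 1958 / Lang 1983: the algebraic closure of `F` in a finitely generated extension `E/F` is finite over `F`) — the
algebraic closure of `κ(π η)` in `κ(η)` is finite-dimensional, and so is the smaller separable closure:

* `essFiniteType_residueField_residueField` — `κ(η)` is essentially of finite type over `κ(π η)`;
* `finiteDimensional_algebraicClosure_residueField`, **`finiteDimensional_separableClosure_residueField`** — the relative
  algebraic / separable closures of `κ(π η)` in `κ(η)` are finite over `κ(π η)` (NO resolution / exceptional-curve /
  normality hypothesis: every point of every scheme locally of finite type over an affine base);
* **`splitWeight_eq_finrank`** — consequently U8's `splitWeight π η = max 1 (finrank …)` IS the finrank (the `max 1` junk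
  guard of `…NoZenoSplitExcCount` is inactive: a nontrivial finite-dimensional algebra has positive finrank), and
  `one_le_finrank_separableClosure_residueField`.

References: J.-P. Serre, *Morphismes universels et variété d'Albanese*, Sém. Chevalley 1958/59, no. 2 Lemme 1 [`Serre1958MorphismesUniversels`];
S. Lang, *Abelian Varieties* (1983) II §3 [`Lang1983AbelianVarieties`] (via the tree file); J. Lipman, Publ. IHÉS 36 (1969) §16 (16.1)
p. 231 (the weights `[κ_i^s : κ]`, context) [`Lipman1969`].
-/

-- single-problem summit: the doubled namespace component `ResolutionOfSingularities` is forced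
set_option linter.dupNamespace false

noncomputable section

namespace Summit.ResolutionOfSingularities.ResolutionOfSingularities.Theorems.NoZeno.ExcCount

open CategoryTheory AlgebraicGeometry IsLocalRing
open Literature.AlgebraicGeometry.Resolution

universe u

section General

variable {R : Type u} [CommRing R] {X : Scheme.{u}} (π : X ⟶ Spec (.of R)) [LocallyOfFiniteType π] (η : X)

/-- **`κ(η)` is essentially of finite type over `κ(π η)`** for `π : X → Spec R` locally of finite type and any `η ∈ X`
(the algebra structure is Mathlib's `π.residueFieldMap η : κ(π η) → κ(η)`): `𝒪_{X,η}` is essentially of finite type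
over `𝒪_{Spec R, π η}` (`LocallyOfFiniteType.stalkMap`), `κ(η)` is a quotient of `𝒪_{X,η}`, and
`𝒪_{Spec R,π η} → κ(π η) → κ(η)` is `𝒪_{Spec R,π η} → 𝒪_{X,η} → κ(η)` (`Scheme.residue_residueFieldMap`). [folklore] -/
theorem essFiniteType_residueField_residueField :
    letI := (π.residueFieldMap η).hom.toAlgebra
    Algebra.EssFiniteType ((Spec (.of R)).residueField (π.base η)) (X.residueField η) := by
  -- the four rings and their algebra structures
  let A := (Spec (CommRingCat.of R)).presheaf.stalk (π.base η)
  let B := X.presheaf.stalk η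
  let K₀ := (Spec (CommRingCat.of R)).residueField (π.base η)
  let K := X.residueField η
  letI : Algebra K₀ K := (π.residueFieldMap η).hom.toAlgebra
  letI : Algebra A B := (π.stalkMap η).hom.toAlgebra
  letI : Algebra B K := (X.residue η).hom.toAlgebra
  letI : Algebra A K₀ := ((Spec (CommRingCat.of R)).residue (π.base η)).hom.toAlgebra
  letI : Algebra A K := ((X.residue η).hom.comp (π.stalkMap η).hom).toAlgebra
  haveI : IsScalarTower A B K := IsScalarTower.of_algebraMap_eq (fun _ => rfl)
  haveI : IsScalarTower A K₀ K := IsScalarTower.of_algebraMap_eq (fun a => by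
    change ((X.residue η).hom.comp (π.stalkMap η).hom) a =
      (π.residueFieldMap η).hom (((Spec (CommRingCat.of R)).residue (π.base η)).hom a)
    rw [← CommRingCat.comp_apply, ← CommRingCat.hom_comp, Scheme.residue_residueFieldMap])
  -- `B` is essentially of finite type over `A`, `K` is a quotient of `B`
  haveI : Algebra.EssFiniteType A B := LocallyOfFiniteType.stalkMap π η
  haveI : Algebra.EssFiniteType B K :=
    Algebra.EssFiniteType.of_surjective (Algebra.ofId B K) (fun x => by
      obtain ⟨b, hb⟩ := Ideal.Quotient.mk_surjective x
      exact ⟨b, hb⟩)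
  haveI : Algebra.EssFiniteType A K := Algebra.EssFiniteType.comp A B K
  exact Algebra.EssFiniteType.of_comp A K₀ K

/-- **The algebraic closure of `κ(π η)` in `κ(η)` is finite over `κ(π η)`** for `π : X → Spec R` locally of finite
type and any `η ∈ X` (`κ(η)/κ(π η)` is a finitely generated field extension, `essFiniteType_residueField_residueField`;
the tree's `Literature.FieldTheory.Regular.finiteDimensional_algebraicClosure`).
[cite: Serre1958MorphismesUniversels, no. 2 Lemme 1] -/
theorem finiteDimensional_algebraicClosure_residueField :
    letI := (π.residueFieldMap η).hom.toAlgebra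
    FiniteDimensional ((Spec (.of R)).residueField (π.base η))
      (algebraicClosure ((Spec (.of R)).residueField (π.base η)) (X.residueField η)) := by
  letI := (π.residueFieldMap η).hom.toAlgebra
  haveI := essFiniteType_residueField_residueField π η
  exact Literature.FieldTheory.Regular.finiteDimensional_algebraicClosure

/-- **The separable closure of `κ(π η)` in `κ(η)` is finite over `κ(π η)`** (the binder `hFW` of the split-count base-change
files, discharged) for `π : X → Spec R` locally of finite type and any `η ∈ X`: the separable closure is contained in the
algebraic closure (separable elements are algebraic), which is finite (`finiteDimensional_algebraicClosure_residueField`).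
[cite: Serre1958MorphismesUniversels, no. 2 Lemme 1] -/
theorem finiteDimensional_separableClosure_residueField :
    letI := (π.residueFieldMap η).hom.toAlgebra
    FiniteDimensional ((Spec (.of R)).residueField (π.base η))
      (separableClosure ((Spec (.of R)).residueField (π.base η)) (X.residueField η)) := by
  letI := (π.residueFieldMap η).hom.toAlgebra
  haveI := finiteDimensional_algebraicClosure_residueField π η
  have hle : separableClosure ((Spec (.of R)).residueField (π.base η)) (X.residueField η) ≤
      algebraicClosure ((Spec (.of R)).residueField (π.base η)) (X.residueField η) :=
    le_algebraicClosure _ _ _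
  exact FiniteDimensional.of_injective (IntermediateField.inclusion hle).toLinearMap
    (IntermediateField.inclusion_injective hle)

/-- **`1 ≤ [κ(π η)^s : κ(π η)]`**: the finrank of the (finite) separable closure is positive. [folklore] -/
theorem one_le_finrank_separableClosure_residueField :
    letI := (π.residueFieldMap η).hom.toAlgebra
    1 ≤ Module.finrank ((Spec (.of R)).residueField (π.base η))
      (separableClosure ((Spec (.of R)).residueField (π.base η)) (X.residueField η)) := by
  letI := (π.residueFieldMap η).hom.toAlgebra
  haveI := finiteDimensional_separableClosure_residueField π η
  exact Module.finrank_pos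

end General

/-- **`splitWeight π η = [κ(π η)^s : κ(π η)]` on the nose** for `π : X → Spec R` locally of finite type (e.g. a resolution
of `Spec R`) and any `η`: the `max 1` junk guard of `splitWeight` (U8, `…NoZenoSplitExcCount`) is inactive because the
separable closure is finite-dimensional (`finiteDimensional_separableClosure_residueField`), so its finrank is `≥ 1`.
[cite: Lipman1969, §16 (16.1) (p. 231)] -/
theorem splitWeight_eq_finrank {R : Type} [CommRing R] {X : Scheme.{0}} (π : X ⟶ Spec (.of R))
    [LocallyOfFiniteType π] (η : X) :
    letI := (π.residueFieldMap η).hom.toAlgebra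
    splitWeight π η = Module.finrank ((Spec (.of R)).residueField (π.base η))
      (separableClosure ((Spec (.of R)).residueField (π.base η)) (X.residueField η)) := by
  letI := (π.residueFieldMap η).hom.toAlgebra
  have h1 := one_le_finrank_separableClosure_residueField π η
  unfold splitWeight
  exact max_eq_right h1

end Summit.ResolutionOfSingularities.ResolutionOfSingularities.Theorems.NoZeno.ExcCount

end
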